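import Summits.HubbardSuperconductivity.HubbardSuperconductivity.Theorems.WeakCouplingBCSKlLindhardEnclosureChord
import Summits.HubbardSuperconductivity.HubbardSuperconductivity.Theorems.WeakCouplingBCSKlLindhardEnclosureFloorRulesOrd

/-!
# KL-MARGIN-SCAN reader (22) «kernel-lindhard-enclosure» — the JENSEN floor rule DISCHARGED

Fourth of the five remaining rule-level debts paid in full, for EVERY parameter record `P` and with NO side condition:
`floorInsideSoundOrd : ∀ P, FloorInsideSoundOrd P` (the ORIENTED Jensen-floor predicate of record, `…FloorRulesOrd`).  Content: on a
guarded, oriented, SQUARE two-shell cell of kind `k` inside `[−piLoZ, piLoZ)² ⊆ BZ` (so the BZ-part of the cell integral is the whole cell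
integral), the two-shell integrand is `F = 1/g_k` with `g_k > 0` (`…TwoShell`); the TANGENT LINE of the convex function `1/x` at the cell
average `m = (∫_cell g_k)/area` gives `F ≥ 2/m − g_k/m²` pointwise, whence JENSEN `∫_cell F ≥ area²/∫_cell g_k`; and
`4·2^40·∫_cell g_k ≤ h²·(SUM4 + interpE)` (corner-mean lemma with the kernel's slack, `SUM4 = Σ gCornerUp`), so
`2^30 ∫_cell F ≥ 2^32·2^40·dz²/(U²·(SUM4 + interpE)) ≥ fdivZ (…) (…)` = the kernel's Jensen numerator.  With this file and `…Chord`,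
the soundness debt of the (22) instrument is exactly the THREE curved-cell rules: boundary floor `FloorBdrySoundOrd`, majorised hyperbola
`CeilBdrySoundOrd`, tip `CeilTipSoundOrd` (`sound_of_three_rulesOrd`).  Honest framing: nothing in this file asserts a KL margin at any
`t′ ≠ 0`, `K₃`, `U₀`, the window or B1g dominance; a Kohn–Luttinger instability statement is not ODLRO and nothing here proves
superconductivity in the Hubbard model.  (p1 g26, 2026-08-29.)
-/

noncomputable section

set_option linter.dupNamespace false

namespace Summit.HubbardSuperconductivity.HubbardSuperconductivity.Theorems.KlLindhardEnclosure

open Real Set MeasureTheory Literature.MathematicalPhysics.QuantumLattice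
open Summit.HubbardSuperconductivity.HubbardSuperconductivity.Theorems

/-- **THE TANGENT OF `1/x`**: for `0 < x`, `0 < m`: `2/m − x/m² ≤ 1/x` (convexity of `x ↦ 1/x`; equality at `x = m`). -/
theorem tangent_le_inv {x m : ℝ} (hx : 0 < x) (hm : 0 < m) : 2 / m - x / m ^ 2 ≤ 1 / x := by
  have key : 1 / x - (2 / m - x / m ^ 2) = (x - m) ^ 2 / (x * m ^ 2) := by
    field_simp
    ring
  have : 0 ≤ (x - m) ^ 2 / (x * m ^ 2) := by positivity
  linarith

/-- A cell inside `[−piLoZ, piLoZ)²` lies inside the Brillouin zone (admissible `P`: `piLoZ < π·U`). -/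
theorem Params.cellSet_subset_brillouinZone (P : Params) (hP : P.admissible = true) {a b c d : ℤ}
    (hbz : P.inBZ (P.mkX a) (P.mkX b) (P.mkY c) (P.mkY d) = true) : P.cellSet a b c d ⊆ brillouinZone := by
  have hU := P.U_pos_of_admissible hP
  have hU' : (0 : ℝ) < (P.U : ℝ) := by exact_mod_cast hU
  have hlo := P.piLoZ_lt_pi_mul hP
  simp only [Params.inBZ, Params.mkX_z, Params.mkY_z, Bool.and_eq_true, decide_eq_true_eq] at hbz
  obtain ⟨⟨⟨ha, hb⟩, hc⟩, hd⟩ := hbz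
  have ha' : -(P.piLoZ : ℝ) ≤ (a : ℝ) := by exact_mod_cast ha
  have hb' : (b : ℝ) ≤ (P.piLoZ : ℝ) := by exact_mod_cast hb
  have hc' : -(P.piLoZ : ℝ) ≤ (c : ℝ) := by exact_mod_cast hc
  have hd' : (d : ℝ) ≤ (P.piLoZ : ℝ) := by exact_mod_cast hd
  have hπ : (P.piLoZ : ℝ) / (P.U : ℝ) < π := by rw [div_lt_iff₀ hU']; linarith
  intro p hp
  simp only [Params.cellSet, mem_setOf_eq, P.cast_toQ] at hp
  obtain ⟨h0a, h0b, h1c, h1d⟩ := hp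
  have e1 : -(P.piLoZ : ℝ) / (P.U : ℝ) ≤ (a : ℝ) / (P.U : ℝ) := div_le_div_of_nonneg_right ha' hU'.le
  have e2 : (b : ℝ) / (P.U : ℝ) ≤ (P.piLoZ : ℝ) / (P.U : ℝ) := div_le_div_of_nonneg_right hb' hU'.le
  have e3 : -(P.piLoZ : ℝ) / (P.U : ℝ) ≤ (c : ℝ) / (P.U : ℝ) := div_le_div_of_nonneg_right hc' hU'.le
  have e4 : (d : ℝ) / (P.U : ℝ) ≤ (P.piLoZ : ℝ) / (P.U : ℝ) := div_le_div_of_nonneg_right hd' hU'.le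
  rw [neg_div] at e1 e3
  intro i
  fin_cases i
  · exact ⟨by simp; linarith, by simp; linarith⟩
  · exact ⟨by simp; linarith, by simp; linarith⟩

/-- For a cell inside `[−piLoZ, piLoZ)²` the BZ-part of the cell integral is the whole cell integral. -/
theorem Params.cellIntBZ_eq_cellInt (P : Params) (hP : P.admissible = true) {a b c d : ℤ}
    (hbz : P.inBZ (P.mkX a) (P.mkX b) (P.mkY c) (P.mkY d) = true) : P.cellIntBZ a b c d = P.cellInt a b c d := by
  unfold Params.cellIntBZ Params.cellInt
  rw [Set.inter_eq_left.mpr (P.cellSet_subset_brillouinZone hP hbz)]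

/-- **THE JENSEN CORE**: on a guarded, oriented, square two-shell cell of kind `k` inside `[−piLoZ, piLoZ)²`, with the kernel's
`0 < SUM4 + interpE`, the Jensen numerator is at most `2^30 ·` the cell integral. -/
theorem Params.jensen_core (P : Params) (hP : P.admissible = true) {a b c d : ℤ} (hin : P.InRoot a b c d) (hab : a ≤ b) (hcd : c ≤ d)
    {k : Bool} (hg : (P.cell (P.mkX a) (P.mkX b) (P.mkY c) (P.mkY d)).guards = true)
    (hs1 : P.status (P.cell (P.mkX a) (P.mkX b) (P.mkY c) (P.mkY d)).e1Lo (P.cell (P.mkX a) (P.mkX b) (P.mkY c) (P.mkY d)).e1Hi = some k)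
    (hs2 : P.status (P.cell (P.mkX a) (P.mkX b) (P.mkY c) (P.mkY d)).e2Lo (P.cell (P.mkX a) (P.mkX b) (P.mkY c) (P.mkY d)).e2Hi = some (!k))
    (hden : 0 < P.gCornerUp k (P.mkX a) (P.mkY c) + P.gCornerUp k (P.mkX b) (P.mkY c) + P.gCornerUp k (P.mkX a) (P.mkY d) +
      P.gCornerUp k (P.mkX b) (P.mkY d) + P.interpE (b - a))
    (hsq : d - c = b - a) (hdz : 0 < b - a) :
    ((fdivZ (2 ^ 32 * D * (b - a) ^ 2) (P.U ^ 2 * (P.gCornerUp k (P.mkX a) (P.mkY c) + P.gCornerUp k (P.mkX b) (P.mkY c) +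
        P.gCornerUp k (P.mkX a) (P.mkY d) + P.gCornerUp k (P.mkX b) (P.mkY d) + P.interpE (b - a))) : ℤ) : ℝ)
      ≤ 2 ^ 30 * P.cellInt a b c d := by
  obtain ⟨htpD, hmuD, hU, -, -⟩ := P.admissible_facts hP
  have hU' : (0 : ℝ) < (P.U : ℝ) := by exact_mod_cast hU
  have hGlo := P.gLo_pos hP hs1 hs2
  have hGlo' : (0 : ℝ) < (((P.cell (P.mkX a) (P.mkX b) (P.mkY c) (P.mkY d)).gLo k : ℤ) : ℝ) := by exact_mod_cast hGlo
  have hint := P.twoShell_integrableOn hP hin hg hs1 hs2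
  have hmeas := P.measurableSet_cellSet a b c d
  have hvol := (P.volume_cellSet_lt_top a b c d).ne
  -- the data as reals
  have hsq' : ((d : ℝ) - (c : ℝ)) = ((b : ℝ) - (a : ℝ)) := by exact_mod_cast (by omega : d - c = b - a)
  have hdz' : (0 : ℝ) < (b : ℝ) - (a : ℝ) := by exact_mod_cast (by omega : (0 : ℤ) < b - a)
  have hden' : (0 : ℝ) < ((P.gCornerUp k (P.mkX a) (P.mkY c) + P.gCornerUp k (P.mkX b) (P.mkY c) + P.gCornerUp k (P.mkX a) (P.mkY d) +
      P.gCornerUp k (P.mkX b) (P.mkY d) + P.interpE (b - a) : ℤ) : ℝ) := by exact_mod_cast hden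
  -- (1) the integral of g: upper bound from the corners, lower bound from Glo
  have hup := (P.integral_gfun_corner_bounds hP k hin (by omega) hsq).2
  have hlow := P.integral_gfun_ge_gLo hP hin hab hcd hg hs1 hs2
  rw [hsq'] at hlow
  have eh : (((b - a : ℤ) : ℝ) / (P.U : ℝ)) ^ 2 = ((b : ℝ) - (a : ℝ)) * ((b : ℝ) - (a : ℝ)) / ((P.U : ℝ) ^ 2) := by
    push_cast; ring
  rw [eh] at hup
  set A := ((b : ℝ) - (a : ℝ)) * ((b : ℝ) - (a : ℝ)) / ((P.U : ℝ) ^ 2) with hA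
  set I := ∫ p in P.cellSet a b c d, P.gfun k p with hI
  set S := ((P.gCornerUp k (P.mkX a) (P.mkY c) + P.gCornerUp k (P.mkX b) (P.mkY c) + P.gCornerUp k (P.mkX a) (P.mkY d) +
      P.gCornerUp k (P.mkX b) (P.mkY d) + P.interpE (b - a) : ℤ) : ℝ) with hS
  have hApos : 0 < A := by rw [hA]; positivity
  have hIpos : 0 < I := by
    have : 0 < A * ((((P.cell (P.mkX a) (P.mkX b) (P.mkY c) (P.mkY d)).gLo k : ℤ) : ℝ) / 2 ^ 40) := by positivity
    linarith
  -- (2) Jensen via the tangent line at m = I/A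
  set m := I / A with hm
  have hmpos : 0 < m := by positivity
  have hcI : IntegrableOn (fun _ : Momentum => (2 / m : ℝ)) (P.cellSet a b c d) volume := integrableOn_const (hs := hvol)
  have htanInt : IntegrableOn (fun p => 2 / m - P.gfun k p / m ^ 2) (P.cellSet a b c d) volume :=
    hcI.sub ((P.gfun_integrableOn k a b c d).div_const _)
  have h2 : (∫ p in P.cellSet a b c d, (2 / m - P.gfun k p / m ^ 2)) ≤ P.cellInt a b c d := by
    unfold Params.cellInt
    refine setIntegral_mono_on htanInt hint hmeas fun p hp => ?_
    rw [P.twoShell_integrand_eq hP hin hg hs1 hs2 hp]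
    obtain ⟨-, -, hpos⟩ := P.twoShell_gfun_mem hP hin hg hs1 hs2 hp
    exact tangent_le_inv hpos hmpos
  have h2e : (∫ p in P.cellSet a b c d, (2 / m - P.gfun k p / m ^ 2)) = A * (2 / m) - I / m ^ 2 := by
    rw [integral_sub hcI ((P.gfun_integrableOn k a b c d).div_const _), setIntegral_const,
      P.volumeReal_cellSet hU hab hcd, smul_eq_mul, integral_div, hsq']
  have hJ : A * A / I ≤ P.cellInt a b c d := by
    have e : A * (2 / m) - I / m ^ 2 = A * A / I := by
      rw [hm]; field_simp; ring
    linarith [h2, h2e.symm.le, h2e.le, e.le, e.symm.le]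
  -- (3) I ≤ A·S/(4·2^40) ⇒ A²/I ≥ 4·2^40·A/S
  have hI_le : 4 * 2 ^ 40 * I ≤ A * S := hup
  have hK : 4 * 2 ^ 40 * A / S ≤ A * A / I := by
    rw [div_le_div_iff₀ hden' hIpos]
    nlinarith [hI_le, hApos]
  have hK' : 4 * 2 ^ 40 * A ≤ P.cellInt a b c d * S := by
    have := hK.trans hJ
    rwa [div_le_iff₀ hden'] at this
  have outer := mul_le_mul_of_nonneg_left hK' (sq_nonneg (P.U : ℝ))
  have hU2 : ((P.U : ℝ) ^ 2) * A = ((b : ℝ) - (a : ℝ)) * ((b : ℝ) - (a : ℝ)) := by rw [hA]; field_simp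
  -- (4) the integer rounding
  have hdenZ : 0 < P.U ^ 2 * (P.gCornerUp k (P.mkX a) (P.mkY c) + P.gCornerUp k (P.mkX b) (P.mkY c) +
      P.gCornerUp k (P.mkX a) (P.mkY d) + P.gCornerUp k (P.mkX b) (P.mkY d) + P.interpE (b - a)) := by positivity
  have hdenZ' : (0 : ℝ) < ((P.U ^ 2 * (P.gCornerUp k (P.mkX a) (P.mkY c) + P.gCornerUp k (P.mkX b) (P.mkY c) +
      P.gCornerUp k (P.mkX a) (P.mkY d) + P.gCornerUp k (P.mkX b) (P.mkY d) + P.interpE (b - a)) : ℤ) : ℝ) := by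
    exact_mod_cast hdenZ
  have rf := fdivZ_le_div (2 ^ 32 * D * (b - a) ^ 2) (P.U ^ 2 * (P.gCornerUp k (P.mkX a) (P.mkY c) +
      P.gCornerUp k (P.mkX b) (P.mkY c) + P.gCornerUp k (P.mkX a) (P.mkY d) + P.gCornerUp k (P.mkX b) (P.mkY d) +
      P.interpE (b - a))) hdenZ
  have rf' := (Rat.cast_le (K := ℝ)).mpr rf
  simp only [Rat.cast_div, Rat.cast_intCast] at rf'
  refine rf'.trans ?_
  rw [div_le_iff₀ hdenZ']
  simp only [Int.cast_mul, Int.cast_pow, Int.cast_sub, Int.cast_ofNat, D]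
  rw [← hS]
  have esq : ((b : ℝ) - (a : ℝ)) ^ 2 = ((P.U : ℝ) ^ 2) * A := by rw [hU2]; ring
  rw [esq]
  linarith [outer]

/-- **THE JENSEN-FLOOR RULE HOLDS for every `P`** (oriented predicate of record). -/
theorem floorInsideSoundOrd (P : Params) : FloorInsideSoundOrd P := by
  intro a b c d k hP hin hab hcd hg hs1 hs2 hbz _hint
  rw [P.cellIntBZ_eq_cellInt hP hbz]
  simp only [Params.floorInside, Params.mkX_z, Params.mkY_z]
  split_ifs with hcond
  · simp only [Bool.and_eq_true, decide_eq_true_eq] at hcond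
    obtain ⟨⟨hden, hsq⟩, hdz⟩ := hcond
    exact P.jensen_core hP hin hab hcd hg hs1 hs2 hden hsq hdz
  · simp only [Int.cast_zero]
    have h0 : 0 ≤ P.cellInt a b c d := setIntegral_nonneg (P.measurableSet_cellSet a b c d) fun p _ => P.integrand_nonneg p
    positivity

/-- **BOTH NAMED PREDICATES OF THE GATE, for every tree, from the THREE remaining (curved-cell) rule predicates**: boundary floor,
majorised hyperbola, tip. -/
theorem sound_of_three_rulesOrd (P : Params) (hB : FloorBdrySoundOrd P) (hBd : CeilBdrySoundOrd P) (hT : CeilTipSoundOrd P)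
    (t : QB) : FloorSoundAt P t ∧ CeilSoundAt P t :=
  ⟨floorSoundAt_of_rulesOrd P (floorInsideSoundOrd P) hB t, ceilSoundAt_of_two_rules P hBd hT t⟩

end Summit.HubbardSuperconductivity.HubbardSuperconductivity.Theorems.KlLindhardEnclosure

end
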